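import Literature.AlgebraicGeometry.Resolution.StrictTransformFlatteningBaseReduction
import HarnessLib

/-!
# The strict transform only depends on the scheme away from the centre

Topic: `Literature/AlgebraicGeometry/Resolution`. Let `b : S' → S` be a morphism with
`b⁻¹𝓘 𝒪_{S'}` an effective Cartier divisor (e.g. the blowing up of `S` in `𝓘`), `f' : X' → S`,
and `j : X → X'` a closed immersion which is an isomorphism over `f'⁻¹(S ∖ V(𝓘))`. Then the
strict transform (Stacks, Tag 080D) of `X → S` along `b` is isomorphic, over `S'`, to the strict
transform of `X' → S`: both are the scheme-theoretic closure of the same open subscheme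
`X ×_S b⁻¹(S ∖ V(𝓘)) = X' ×_S b⁻¹(S ∖ V(𝓘))`, computed in `X ×_S S'` resp. in `X' ×_S S'`, and
scheme-theoretic images are insensitive to composition with the closed immersion
`X ×_S S' → X' ×_S S'`. This is the remark used in the proof of Stacks, Tag 0810 (first
paragraph: one may replace a module by a finitely presented one with the same restriction to
`U`) and, for schemes, in Raynaud–Gruson's reduction of the flattening theorem to finitely
presented data.

* `blowupStrictTransformMap_comp_iff_of_isClosedImmersion` — **for `P` respecting isomorphisms,
  `P` holds for the strict transform of `j ≫ f'` iff it holds for the strict transform of `f'`.**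

## References

* The Stacks Project, Tag 080D (strict transform), Tag 0810 (proof, ¶1), Tag 01R8
  (scheme-theoretic image). [StacksProject]
* M. Raynaud, L. Gruson, *Critères de platitude et de projectivité*, Invent. Math. 13 (1971),
  Première partie, §5.2. [RaynaudGruson1971]
-/

noncomputable section

open CategoryTheory CategoryTheory.Limits AlgebraicGeometry TopologicalSpace

namespace Literature.AlgebraicGeometry.Resolution

universe u

variable {X X' S S' : Scheme.{u}} (j : X ⟶ X') (f' : X' ⟶ S) (b : S' ⟶ S) (I : S.IdealSheafData)

/-- **Scheme-theoretic images are insensitive to closed immersions of the target**: for a closed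
immersion `g : Z → T'` and a morphism `s : T' → S'`, a property of morphisms respecting
isomorphisms holds for `im(g) → S'` iff it holds for `Z → S'` (`Z → im(g)` is an isomorphism).
[cite: StacksProject, Tag 01R8] -/
theorem ker_subschemeι_comp_iff_of_isClosedImmersion (P : MorphismProperty Scheme.{u})
    [P.RespectsIso] {Z T' : Scheme.{u}} (g : Z ⟶ T') [IsClosedImmersion g] (s : T' ⟶ S') :
    P (g.ker.subschemeι ≫ s) ↔ P (g ≫ s) := by
  change P (g.imageι ≫ s) ↔ P (g ≫ s)
  rw [← P.cancel_left_of_respectsIso g.toImage, Scheme.Hom.toImage_imageι_assoc]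

/-- **The strict transform only depends on the scheme away from the centre.** Let
`j : X → X'` be a closed immersion of `S`-schemes (`f = j ≫ f'`) which is an isomorphism over
`f'⁻¹(S ∖ V(𝓘))`, and `b : S' → S` with `b⁻¹𝓘 𝒪_{S'}` an effective Cartier divisor. Then a
property of morphisms respecting isomorphisms holds for the strict transform of `X` along `b`
iff it holds for the strict transform of `X'`: identifying `X ×_S S'` with
`X ×_{X'} (X' ×_S S')`, the closed immersion `X ×_S S' → X' ×_S S'` restricts to an isomorphism
between the dense opens over `b⁻¹(S ∖ V(𝓘))`, so the two strict transforms are the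
scheme-theoretic images of the same open subscheme in `X ×_S S'` and in `X' ×_S S'`, which agree
(`ker_subschemeι_comp_iff_of_isClosedImmersion`).
[cite: StacksProject, Tag 0810 (proof, ¶1) with Tag 080D] -/
theorem blowupStrictTransformMap_comp_iff_of_isClosedImmersion (P : MorphismProperty Scheme.{u})
    [P.RespectsIso] [IsClosedImmersion j] [IsIso (j ∣_ f' ⁻¹ᵁ centreCompl I)]
    (hE : IsEffectiveCartier (I.comap b)) :
    P (blowupStrictTransformMap (j ≫ f') b I) ↔ P (blowupStrictTransformMap f' b I) := by
  -- Step 1: compute the strict transform of `X` inside `X ×_{X'} (X' ×_S S') ≅ X ×_S S'`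
  haveI : QuasiCompact ((pullback.snd (j ≫ f') b) ⁻¹ᵁ (b ⁻¹ᵁ centreCompl I)).ι := by
    rw [preimage_centreCompl]
    exact quasiCompact_ι_preimage_centreCompl _ hE
  have step1 := subschemeι_ker_ι_comp_iff_of_iso (pullbackRightPullbackFstIso f' b j).hom
    (pullback.snd (j ≫ f') b)
    (pullback.snd j (pullback.fst f' b) ≫ pullback.snd f' b)
    ((pullback.snd (j ≫ f') b) ⁻¹ᵁ (b ⁻¹ᵁ centreCompl I))
    ((pullback.snd j (pullback.fst f' b)) ⁻¹ᵁ ((pullback.snd f' b) ⁻¹ᵁ (b ⁻¹ᵁ centreCompl I)))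
    P (pullbackRightPullbackFstIso_hom_snd f' b j) (by
      simp only [← Scheme.Hom.comp_preimage, pullbackRightPullbackFstIso_hom_snd_assoc])
  change P (((pullback.snd (j ≫ f') b) ⁻¹ᵁ (b ⁻¹ᵁ centreCompl I)).ι.ker.subschemeι ≫
      pullback.snd (j ≫ f') b) ↔
    P (((pullback.snd f' b) ⁻¹ᵁ (b ⁻¹ᵁ centreCompl I)).ι.ker.subschemeι ≫ pullback.snd f' b)
  rw [step1]
  -- Step 2: the closed immersion `jb : X ×_{X'} (X' ×_S S') → X' ×_S S'` is an isomorphism over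
  -- the dense open `O'` over `b⁻¹(S ∖ V(𝓘))`
  have hO' : (pullback.fst f' b) ⁻¹ᵁ (f' ⁻¹ᵁ centreCompl I) =
      (pullback.snd f' b) ⁻¹ᵁ (b ⁻¹ᵁ centreCompl I) := by
    rw [← Scheme.Hom.comp_preimage, pullback.condition, Scheme.Hom.comp_preimage]
  haveI : IsIso (pullback.snd j (pullback.fst f' b) ∣_
      (pullback.snd f' b) ⁻¹ᵁ (b ⁻¹ᵁ centreCompl I)) := by
    have h := pullback_snd_morphismRestrict_preimage (MorphismProperty.isomorphisms Scheme.{u}) j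
      (pullback.fst f' b) (f' ⁻¹ᵁ centreCompl I)
      ((MorphismProperty.isomorphisms.iff _).mpr inferInstance)
    rw [hO'] at h
    exact (MorphismProperty.isomorphisms.iff _).mp h
  -- hence the ideal of the strict transform of `X'` is the kernel of
  -- `closure(O) ⊆ X ×_{X'} (X' ×_S S') → X' ×_S S'`
  have hker : ((pullback.snd f' b) ⁻¹ᵁ (b ⁻¹ᵁ centreCompl I)).ι.ker =
      (((pullback.snd j (pullback.fst f' b)) ⁻¹ᵁ
          ((pullback.snd f' b) ⁻¹ᵁ (b ⁻¹ᵁ centreCompl I))).ι.ker.subschemeι ≫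
        pullback.snd j (pullback.fst f' b)).ker := by
    rw [Scheme.Hom.ker_comp, Scheme.IdealSheafData.ker_subschemeι, ← Scheme.Hom.ker_comp,
      ← morphismRestrict_ι, Scheme.Hom.ker_comp_of_isIso]
  rw [hker, ker_subschemeι_comp_iff_of_isClosedImmersion P (_ ≫ pullback.snd j (pullback.fst f' b)),
    Category.assoc]

end Literature.AlgebraicGeometry.Resolution

end
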